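import Mathlib
import HarnessLib
import Summits.CriticalPhenomena.SAWScalingLimit.Theorems.SAWSpinMonotoneQCIdentificationDefs
import Summits.CriticalPhenomena.SAWScalingLimit.Theorems.SAWSpinMonotoneQCIdentificationNoBranchingAlgebra
import Summits.CriticalPhenomena.SAWScalingLimit.Theorems.SAWSpinMonotoneQCIdentificationAffineDictionary

/-!
# The no-fold bound in the affine dictionary: quasiconformal pieces and no collapse

Helper file (sub-goal L2 of `STUB-REPORT-subsequentialLimits.md` §3; companion of the affine
dictionary `SAWSpinMonotoneQCIdentificationAffineDictionary.lean`, sub-goal L1, whose `belt`, `alpha`,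
`beta` it uses) of the stubs
`stub_subsequentialLimits` and `stub_rayCondition` of line `eight_fifths_primitive`, crux
`QCIdentification` (stmt-CriticalPhenomena-16772); namespace of the checked skeleton, sub-namespace
`Dev`; vocabulary from `SAWSpinMonotoneQCIdentificationDefs` (`Fobs`, `hexNbr`, `modeSum`) and the
algebraic core `SAWSpinMonotoneQCIdentificationNoBranchingAlgebra` (`NB.modeSum_ne_zero_of_adj`,
`NB.modeSum_source_ne_zero`).

**What.** (1) The no-fold bound (K) at a fixed constant, `NoFoldBoundWith k` (so that
`NoFoldBound ↔ ∃ k < 1, NoFoldBoundWith k` definitionally, `noFoldBound_iff`), reads in the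
vocabulary of the affine dictionary (`belt`, `alpha = cAlpha · modeSum`, `beta = cBeta · belt`,
`|cAlpha| = |cBeta|`): `‖belt F v‖ ≤ k ‖modeSum F v‖` (`norm_belt_le`) and `‖beta F v‖ ≤ k ‖alpha F v‖`
(`norm_beta_le`, strict on non-degenerate faces `norm_beta_lt`; registered `dev_norm_beta_le`) — the
affine pieces `z ↦ α z + β z̄ + γ` of the developing map are uniformly `K`-quasiconformal,
`K = (1 + k)/(1 - k)`, wherever `S(v) ≠ 0`.
(2) **No collapse.** Under (K), for a simply connected hexagonal domain `Λ` with boundary source `a`,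
the `∂H`-mode `S(v) = modeSum (Fobs Λ a) v` is non-zero at every vertex `v ∈ Λ` joined INSIDE `Λ` to
the inner endpoint `va` of `a` (`modeSum_ne_zero_of_reachable`, registered
`dev_modeSum_ne_zero_of_reachable`); in particular everywhere when the induced graph `ℍ[Λ]` is
preconnected, as it is for admissible discretisations (`modeSum_ne_zero_of_preconnected`, registered
`dev_modeSum_ne_zero_of_preconnected`). So no triangle of the source component is collapsed: every
affine piece there is a non-degenerate orientation-preserving `K`-quasiconformal real-linear map.

**Proof of (2).** The source face is non-degenerate because `F(a) = 1` sits on one of its mid-edges and a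
degenerate face carries `F = 0` on all three (`NB.modeSum_source_ne_zero`); non-degeneracy passes to
`Λ`-neighbours (`NB.modeSum_ne_zero_of_adj`: the shared mid-edge value is non-zero from one side and
would be zero from the other), hence along walks of `ℍ[Λ]` by induction (`modeSum_ne_zero_of_walk`).

Source: H. Duminil-Copin, S. Smirnov, Ann. of Math. 175 (2012) 1653–1665 (arXiv:1007.0575), Lemma 1
(through the algebraic core); the propagation argument is the stub report's L2.
-/

noncomputable section

open Literature.Probability.LatticeModels Literature.Probability.RandomPlanarGeometry.SAW
open Summit.CriticalPhenomena.SAWScalingLimit.Theses.SAWDevelopingMap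

namespace Summit.CriticalPhenomena.SAWScalingLimit.Cruxes.QCIdentification.EightFifthsPrimitive

namespace Dev

open NB

/-! ### The no-fold bound at a fixed constant: quasiconformality of the affine pieces -/

/-- The no-fold bound (K) **at a fixed constant** `k`: verbatim the body of `NoFoldBound` after
`∃ k, k < 1 ∧`, with the two `let`s substituted (`Fobs`, `NB.omg`). -/
def NoFoldBoundWith (k : ℝ) : Prop :=
  ∀ (Λ : Finset HexVertex), hexDomainSimplyConnected Λ → ∀ a ∈ hexDomainBoundary Λ, ∀ v ∈ Λ,
    ∀ w₀ w₁ w₂ : HexVertex, hexGraph.Adj v w₀ → hexGraph.Adj v w₁ → hexGraph.Adj v w₂ →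
      w₀ ≠ w₁ → w₁ ≠ w₂ → w₀ ≠ w₂ →
        ‖Fobs Λ a s(v, w₀) + omg * Fobs Λ a s(v, w₁) + omg ^ 2 * Fobs Λ a s(v, w₂)‖ ≤
          k * ‖Fobs Λ a s(v, w₀) + Fobs Λ a s(v, w₁) + Fobs Λ a s(v, w₂)‖

/-- `NoFoldBound` is `∃ k < 1, NoFoldBoundWith k` (definitional). -/
theorem noFoldBound_iff : NoFoldBound ↔ ∃ k : ℝ, k < 1 ∧ NoFoldBoundWith k := Iff.rfl

/-- **(K) bounds the Beltrami mode by the `∂H`-mode**: `‖B(v)‖ ≤ k ‖S(v)‖`. -/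
theorem norm_belt_le {k : ℝ} (hk : NoFoldBoundWith k) {Λ : Finset HexVertex}
    (hΛ : hexDomainSimplyConnected Λ) {a : Sym2 HexVertex} (ha : a ∈ hexDomainBoundary Λ)
    {v : HexVertex} (hv : v ∈ Λ) : ‖belt (Fobs Λ a) v‖ ≤ k * ‖modeSum (Fobs Λ a) v‖ := by
  have h := hk Λ hΛ a ha v hv (hexNbr v 0) (hexNbr v 2) (hexNbr v 1) (adj_hexNbr v 0)
    (adj_hexNbr v 2) (adj_hexNbr v 1) (hexNbr_ne v (by decide)) (hexNbr_ne v (by decide))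
    (hexNbr_ne v (by decide))
  have hB : belt (Fobs Λ a) v =
      Fobs Λ a s(v, hexNbr v 0) + omg * Fobs Λ a s(v, hexNbr v 2) +
        omg ^ 2 * Fobs Λ a s(v, hexNbr v 1) := by
    unfold belt; ring
  have hS : modeSum (Fobs Λ a) v =
      Fobs Λ a s(v, hexNbr v 0) + Fobs Λ a s(v, hexNbr v 2) + Fobs Λ a s(v, hexNbr v 1) := by
    unfold modeSum; ring
  rw [hB, hS]
  exact h

/-- **(K) in affine form**: `‖β(v)‖ ≤ k ‖α(v)‖` (`|cα| = |cβ| = √3/18`), i.e. the affine map on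
`Δ_v` is `K`-quasiconformal with `K = (1 + k)/(1 - k)` wherever `S(v) ≠ 0`. -/
theorem norm_beta_le {k : ℝ} (hk : NoFoldBoundWith k) {Λ : Finset HexVertex}
    (hΛ : hexDomainSimplyConnected Λ) {a : Sym2 HexVertex} (ha : a ∈ hexDomainBoundary Λ)
    {v : HexVertex} (hv : v ∈ Λ) : ‖beta (Fobs Λ a) v‖ ≤ k * ‖alpha (Fobs Λ a) v‖ := by
  have h := norm_belt_le hk hΛ ha hv
  rw [beta, alpha, norm_mul, norm_mul, norm_cBeta, norm_cAlpha]
  have hs : (0 : ℝ) ≤ Real.sqrt 3 / 18 := by positivity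
  nlinarith [mul_le_mul_of_nonneg_left h hs]

/-- Under (K), on a non-degenerate face the `∂̄`-coefficient is STRICTLY smaller than the
`∂`-coefficient: the affine map on `Δ_v` is an orientation-preserving real-linear isomorphism. -/
theorem norm_beta_lt {k : ℝ} (hk1 : k < 1) (hk : NoFoldBoundWith k) {Λ : Finset HexVertex}
    (hΛ : hexDomainSimplyConnected Λ) {a : Sym2 HexVertex} (ha : a ∈ hexDomainBoundary Λ)
    {v : HexVertex} (hv : v ∈ Λ) (hS : modeSum (Fobs Λ a) v ≠ 0) :
    ‖beta (Fobs Λ a) v‖ < ‖alpha (Fobs Λ a) v‖ := by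
  have h := norm_beta_le hk hΛ ha hv
  have hpos : 0 < ‖alpha (Fobs Λ a) v‖ :=
    norm_pos_iff.2 (fun h0 => hS ((alpha_eq_zero_iff _ _).1 h0))
  nlinarith

/-! ### Propagation along walks, reachability, connectedness -/

/-- **Non-degeneracy propagates along walks inside `Λ` (under (K))**, by induction on the walk
from `NB.modeSum_ne_zero_of_adj`. -/
theorem modeSum_ne_zero_of_walk (hK : NoFoldBound) {Λ : Finset HexVertex}
    (hΛ : hexDomainSimplyConnected Λ) {a : Sym2 HexVertex} (ha : a ∈ hexDomainBoundary Λ) :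
    ∀ {x y : (Λ : Set HexVertex)}, (hexGraph.induce (Λ : Set HexVertex)).Walk x y →
      modeSum (Fobs Λ a) x ≠ 0 → modeSum (Fobs Λ a) y ≠ 0 := by
  intro x y p
  induction p with
  | nil => exact id
  | @cons x' y' _ hxy _ ih =>
    exact fun hx =>
      ih (modeSum_ne_zero_of_adj hK hΛ ha x'.2 y'.2 (SimpleGraph.induce_adj.1 hxy) hx)

/-- **No collapse on the source component (under (K)).** If `va ∈ Λ` is the inner endpoint of the
boundary source `a` and `v ∈ Λ` is joined to `va` inside `Λ`, then `S(v) ≠ 0`: the source face is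
non-degenerate (`F(a) = 1`, `NB.modeSum_source_ne_zero`) and non-degeneracy propagates along
`Λ`-adjacency (`modeSum_ne_zero_of_walk`). -/
theorem modeSum_ne_zero_of_reachable (hK : NoFoldBound) {Λ : Finset HexVertex}
    (hΛ : hexDomainSimplyConnected Λ) {a : Sym2 HexVertex} (ha : a ∈ hexDomainBoundary Λ)
    {va : HexVertex} (hmem : va ∈ a) (hva : va ∈ Λ) {v : HexVertex} (hv : v ∈ Λ)
    (hreach : (hexGraph.induce (Λ : Set HexVertex)).Reachable ⟨va, hva⟩ ⟨v, hv⟩) :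
    modeSum (Fobs Λ a) v ≠ 0 := by
  obtain ⟨p⟩ := hreach
  refine modeSum_ne_zero_of_walk hK hΛ ha p ?_
  show modeSum (Fobs Λ a) va ≠ 0
  obtain ⟨he, u, v', rfl, -, hu⟩ := id ha
  rcases Sym2.mem_iff.1 hmem with rfl | rfl
  · exact absurd hva hu
  · exact modeSum_source_ne_zero hK hΛ hva hu ((SimpleGraph.mem_edgeSet hexGraph).1 he).symm

/-- **No collapse, connected form.** Under (K), if the induced graph `ℍ[Λ]` is preconnected (as for
admissible discretisations) then `S(v) ≠ 0` at every `v ∈ Λ`. -/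
theorem modeSum_ne_zero_of_preconnected (hK : NoFoldBound) {Λ : Finset HexVertex}
    (hΛ : hexDomainSimplyConnected Λ)
    (hpc : (hexGraph.induce (Λ : Set HexVertex)).Preconnected) {a : Sym2 HexVertex}
    (ha : a ∈ hexDomainBoundary Λ) {v : HexVertex} (hv : v ∈ Λ) : modeSum (Fobs Λ a) v ≠ 0 := by
  obtain ⟨-, u, va, rfl, hva, -⟩ := id ha
  exact modeSum_ne_zero_of_reachable hK hΛ ha (Sym2.mem_mk_right u va) hva hv (hpc _ _)

/-! ### Registered entry points (∀-telescopes) -/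

/-- **(K) in affine form (registered form)** — one `k < 1` with `‖belt‖ ≤ k ‖modeSum‖` and
`‖β‖ ≤ k ‖α‖` on every face of every simply connected domain with boundary source. -/
theorem dev_norm_beta_le : NoFoldBound → ∃ k : ℝ, k < 1 ∧ ∀ {Λ : Finset HexVertex}, hexDomainSimplyConnected Λ → ∀ {a : Sym2 HexVertex}, a ∈ hexDomainBoundary Λ → ∀ {v : HexVertex}, v ∈ Λ → ‖belt (Fobs Λ a) v‖ ≤ k * ‖modeSum (Fobs Λ a) v‖ ∧ ‖beta (Fobs Λ a) v‖ ≤ k * ‖alpha (Fobs Λ a) v‖ :=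
  fun ⟨k, hk1, hk⟩ => ⟨k, hk1, fun hΛ _ ha _ hv => ⟨norm_belt_le hk hΛ ha hv, norm_beta_le hk hΛ ha hv⟩⟩

/-- **L2 (registered form): no collapse on the source component.** -/
theorem dev_modeSum_ne_zero_of_reachable : NoFoldBound → ∀ {Λ : Finset HexVertex}, hexDomainSimplyConnected Λ → ∀ {a : Sym2 HexVertex}, a ∈ hexDomainBoundary Λ → ∀ {va : HexVertex}, va ∈ a → ∀ (hva : va ∈ Λ) {v : HexVertex} (hv : v ∈ Λ), (hexGraph.induce (Λ : Set HexVertex)).Reachable ⟨va, hva⟩ ⟨v, hv⟩ → modeSum (Fobs Λ a) v ≠ 0 :=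
  fun hK _ hΛ _ ha _ hmem hva _ hv h => modeSum_ne_zero_of_reachable hK hΛ ha hmem hva hv h

/-- **L2, connected form (registered form).** -/
theorem dev_modeSum_ne_zero_of_preconnected : NoFoldBound → ∀ {Λ : Finset HexVertex}, hexDomainSimplyConnected Λ → (hexGraph.induce (Λ : Set HexVertex)).Preconnected → ∀ {a : Sym2 HexVertex}, a ∈ hexDomainBoundary Λ → ∀ {v : HexVertex}, v ∈ Λ → modeSum (Fobs Λ a) v ≠ 0 :=
  fun hK _ hΛ hpc _ ha _ hv => modeSum_ne_zero_of_preconnected hK hΛ hpc ha hv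

end Dev

end Summit.CriticalPhenomena.SAWScalingLimit.Cruxes.QCIdentification.EightFifthsPrimitive

end
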